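/- Copyright: ym-fleet seat `ym-infvol-p3` (prover, g4), for crux `HistoryTail` (stmt-QuantumFields-18916) of route
`UnitScaleTilt`, STUB 3 «chessboard ∕ reflection positivity» of the v5′ skeleton.  Released under the licence of the
surrounding project. -/
import Summits.QuantumFields.YangMills.Theorems.UnitScaleTiltHistoryTailChessboardMirror
import Summits.QuantumFields.BalabanUV.T4Continuum.Support.HistoryChessboardRP

/-!
# Chessboard for ONE top-level plaquette of the Gibbs tower, file 3: THE ESTIMATE

Support file (helper lemmas, `--supports stmt-QuantumFields-18916`) for STUB 3 `stub_chessboardRP` of the v5′ birth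
skeleton of crux `HistoryTail` (route `UnitScaleTilt`): **the multiple-reflection (chessboard) bound of
Fröhlich–Israel–Lieb–Simon ∕ Glimm–Jaffe §10.5 for the event «the `K`-fold block-averaged plaquette variable `Ū^K(∂p)`
has `dist1` in `B`» under the `SU(n)` Wilson–Gibbs state on Bałaban's torus** — general `P : Params` (any dimension),
any measurable `B ⊆ ℝ`, any measurable small-loop averages, `0 ≤ β`:

  `Gibbs{dist1 Ū^K(∂p) ∈ B} ≤ Gibbs{∀ c, dist1 Ū^K(∂ (mirror p c)) ∈ B} ^ (1 ∕ N^d)`,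

the `N^d` plaquettes `mirror p c` being the mirror copies of `p` over the cubes of side `M` of the level-`K` lattice
(`sitesPerDir K = M·N`, `N` even; file 2).  Everything rests on the T⁴ cell's «History chessboard road» BY NAME: the five
RP fields of the Gibbs tower law at the cube cuts (`HistoryChessboardEventsCubes.cutoffRP_towerLaw_gibbs_SU_cubes` — the
tree's Osterwalder–Seiler reflection positivity transported to Bałaban's torus and induced up the tower of block
averagings), the chessboard fields from bounded reflection positivity (`HistoryChessboardRP.chessboardFields_of_
isReflectionPositiveBdd`) and the Literature chessboard estimate `chessboard_le_rpow_even`.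

WHAT.  §1 (abstract probability space) **`measureReal_le_rpow_of_rp`** — for events `E c` indexed by the block torus,
positive-measurable on positive halves and reflection-related, with the five RP fields at every block hyperplane:
`μ(E c₀) ≤ μ(⋂_c E c)^{1∕N^d}`, INCLUDING the degenerate case `μ(⋂_c E c) = 0` (the tree's `chessboard_le_rpow_even`
wants `ψ univ > 0`; we run it on the `ε`-regularised cell observables `ε + (1 − ε)·𝟙_{E c}` and let `ε → 0`).
§2 **`towerLaw_real_le_rpow_mirror`** — the estimate for one top plaquette on the Gibbs TOWER (`loc` ∕ `sym` from files
1–2); §3 **`gibbs_real_iter_le_rpow_mirror`** — the same pulled back to the Gibbs state and the `K`-fold average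
`Averaging.iter` (`towerLaw_eq_map`, `last_towerPt`), which is the currency of `HistoryTail`'s STUB 3.

HONEST SCOPE.  Soft finite-torus reflection-positivity bookkeeping over tree theorems; no estimate of Bałaban's papers is
used or asserted; the crux `HistoryTail` and route `UnitScaleTilt` stay CONDITIONAL on the (α) input package; STUB 3 in
the lead's exact letters (the `T3Family` torus, `tdist`-separation and the cell count) is a corollary to be drawn once
the v5′ text is registered.  Not infinite volume, not a gap, not Clay.
-/

namespace Summit.QuantumFields.YangMills.Theorems.HistoryTailChessboardOnePlaquette

open MeasureTheory Filter Topology Finset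
open Literature.Barriers.CriticalPhenomena.NonGibbs Literature.Probability.LatticeModels
open Literature.MathematicalPhysics.QuantumFieldTheory
open Literature.MathematicalPhysics.QuantumFieldTheory.LatticeRP (IsReflectionPositiveBdd)
open Literature.MathematicalPhysics.QuantumFieldTheory.Balaban1983to89
open BlockAveraging
open Summit.QuantumFields.BalabanUV.T4Continuum
open HistoryRPHalfTorus HistoryRPTowerLaw HistoryRPTowerCuts HistoryChessboardRP HistoryChessboardTowerRepr
open HistoryChessboardEventsCubes HistoryChessboardEventsCubeSites
open Summit.QuantumFields.YangMills.Theorems.HistoryTailChessboardTopField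
open Summit.QuantumFields.YangMills.Theorems.HistoryTailChessboardMirror

noncomputable section

/-! ## §1 The chessboard bound for a reflection-related family of events, zero case included -/

section Abstract

/-- the `ε`-regularised indicator `ε + (1 − ε)·𝟙_E` lies in `[0, 1]` for `ε ∈ [0, 1]`. [folklore] -/
theorem reg_mem_Icc {Ω : Type*} {ε : ℝ} (h0 : 0 ≤ ε) (h1 : ε ≤ 1) (E : Set Ω) (ω : Ω) :
    0 ≤ ε + (1 - ε) * E.indicator (fun _ => (1 : ℝ)) ω ∧ ε + (1 - ε) * E.indicator (fun _ => (1 : ℝ)) ω ≤ 1 := by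
  by_cases hω : ω ∈ E
  · rw [Set.indicator_of_mem hω]; constructor <;> linarith
  · rw [Set.indicator_of_notMem hω]; constructor <;> linarith

variable {Ω : Type*} [m : MeasurableSpace Ω] {μ : Measure Ω} [IsProbabilityMeasure μ] {d N : ℕ} [NeZero N]

/-- **THE CHESSBOARD BOUND FOR ONE CELL EVENT, ZERO CASE INCLUDED.**  On a probability space with, at every block
hyperplane `(i, k)` of the block torus `(ℤ∕N)^d` (`N` even), a positive sub-σ-algebra `mP i k`, a measurable
measure-preserving involution `θ i k` and bounded reflection positivity of `μ` for `(mP i k, θ i k)`, a family of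
events `E c` that is positive-measurable on the positive halves and reflection-related
(`θ i k ω ∈ E c ↔ ω ∈ E (cellReflect i k c)`) satisfies `μ (E c₀) ≤ μ (⋂_c E c) ^ (1 ∕ N^d)`.  Proof: the tree's
`chessboardFields_of_isReflectionPositiveBdd` + `chessboard_le_rpow_even` for the cell observables
`ε + (1 − ε)·𝟙_{E c}` (whose full product has positive mean `≥ ε^{N^d}`), then `ε → 0`. [folklore] -/
theorem measureReal_le_rpow_of_rp (mP : Fin d → ZMod N → MeasurableSpace Ω) (hmP : ∀ i k, mP i k ≤ m)
    (θ : Fin d → ZMod N → Ω → Ω) (hθm : ∀ i k, Measurable (θ i k))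
    (hθ : ∀ i k, MeasurePreserving (θ i k) μ μ) (hθθ : ∀ i k, θ i k ∘ θ i k = id)
    (hRP : ∀ i k, IsReflectionPositiveBdd μ (mP i k) (θ i k)) (hN : Even N)
    (E : BlockIdx d N → Set Ω) (hEm : ∀ c, MeasurableSet (E c))
    (hEP : ∀ (i : Fin d) (k : ZMod N), ∀ c ∈ halfPlus N i k, MeasurableSet[mP i k] (E c))
    (hcov : ∀ (i : Fin d) (k : ZMod N) (c : BlockIdx d N) (ω : Ω), θ i k ω ∈ E c ↔ ω ∈ E (cellReflect i k c))
    (c₀ : BlockIdx d N) :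
    μ.real (E c₀) ≤ (μ.real (⋂ c, E c)) ^ ((1 : ℝ) / (N : ℝ) ^ d) := by
  classical
  set a : ℝ := μ.real (⋂ c, E c) with ha_def
  set r : ℝ := (1 : ℝ) / (N : ℝ) ^ d with hr_def
  have hr : 0 < r := by
    have hNpos : (0 : ℝ) < (N : ℝ) ^ d := by
      have : (0 : ℝ) < N := by exact_mod_cast Nat.pos_of_ne_zero (NeZero.ne N)
      positivity
    rw [hr_def]; positivity
  have ha0 : 0 ≤ a := measureReal_nonneg
  have hInter : MeasurableSet (⋂ c, E c) := MeasurableSet.iInter hEm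
  -- the estimate for every `ε ∈ (0, 1]`
  have key : ∀ ε : ℝ, 0 < ε → ε ≤ 1 → μ.real (E c₀) ≤ (a + ε) ^ r := by
    intro ε hε0 hε1
    -- the regularised cell observables
    set b : BlockIdx d N → Ω → ℝ := fun c ω => ε + (1 - ε) * (E c).indicator (fun _ => (1 : ℝ)) ω with hb_def
    have hb01 : ∀ c ω, 0 ≤ b c ω ∧ b c ω ≤ 1 := fun c ω => reg_mem_Icc hε0.le hε1 (E c) ω
    have hbm : ∀ c, Measurable (b c) := fun c =>
      measurable_const.add (measurable_const.mul (measurable_const.indicator (hEm c)))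
    have hbP : ∀ (i : Fin d) (k : ZMod N), ∀ c ∈ halfPlus N i k, Measurable[mP i k] (b c) := by
      intro i k c hc
      have hind : Measurable[mP i k] ((E c).indicator fun _ => (1 : ℝ)) :=
        Measurable.indicator (@measurable_const ℝ Ω _ (mP i k) 1) (hEP i k c hc)
      exact (hind.const_mul (1 - ε)).const_add ε
    have hcovb : ∀ (i : Fin d) (k : ZMod N) (c : BlockIdx d N) (ω : Ω), b c (θ i k ω) = b (cellReflect i k c) ω := by
      intro i k c ω
      simp only [hb_def]
      by_cases hω : ω ∈ E (cellReflect i k c)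
      · rw [Set.indicator_of_mem hω, Set.indicator_of_mem ((hcov i k c ω).2 hω)]
      · rw [Set.indicator_of_notMem hω, Set.indicator_of_notMem (fun h' => hω ((hcov i k c ω).1 h'))]
    set ψ : Finset (BlockIdx d N) → ℝ := fun S => ∫ ω, ∏ c ∈ S, b c ω ∂μ with hψ_def
    obtain ⟨h0, hempty, hcs⟩ := chessboardFields_of_isReflectionPositiveBdd mP hmP θ hθm hθ hθθ hRP hN b hbP
      (fun c ω => (hb01 c ω).1) (fun c ω => (hb01 c ω).2) hcovb ψ (fun S => rfl)
    -- integrability of the cell products (bounded measurable on a probability space)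
    have hprod_meas : ∀ S : Finset (BlockIdx d N), Measurable fun ω => ∏ c ∈ S, b c ω := fun S =>
      Finset.measurable_prod S fun c _ => hbm c
    have hprod01 : ∀ (S : Finset (BlockIdx d N)) (ω : Ω), 0 ≤ ∏ c ∈ S, b c ω ∧ ∏ c ∈ S, b c ω ≤ 1 := fun S ω =>
      ⟨prod_nonneg fun c _ => (hb01 c ω).1, prod_le_one (fun c _ => (hb01 c ω).1) fun c _ => (hb01 c ω).2⟩
    have hprod_int : ∀ S : Finset (BlockIdx d N), Integrable (fun ω => ∏ c ∈ S, b c ω) μ := fun S =>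
      Integrable.of_bound (hprod_meas S).aestronglyMeasurable 1 (ae_of_all _ fun ω => by
        rw [Real.norm_eq_abs, abs_of_nonneg (hprod01 S ω).1]; exact (hprod01 S ω).2)
    -- `ψ univ ≥ ε^{#cells} > 0`
    have h1 : 0 < ψ univ := by
      have hle : ∫ _ω, ε ^ (univ : Finset (BlockIdx d N)).card ∂μ ≤ ψ univ := by
        refine integral_mono (integrable_const _) (hprod_int univ) fun ω => ?_
        show ε ^ (univ : Finset (BlockIdx d N)).card ≤ ∏ c ∈ univ, b c ω
        rw [← prod_const]
        exact prod_le_prod (fun c _ => hε0.le) fun c _ => by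
          show ε ≤ ε + (1 - ε) * (E c).indicator (fun _ => (1 : ℝ)) ω
          have : 0 ≤ (E c).indicator (fun _ => (1 : ℝ)) ω :=
            Set.indicator_nonneg (fun _ _ => zero_le_one) ω
          nlinarith
      rw [integral_const, smul_eq_mul, probReal_univ, one_mul] at hle
      exact lt_of_lt_of_le (pow_pos hε0 _) hle
    -- the chessboard estimate at `S = {c₀}`
    have hcb := chessboard_le_rpow_even hN h0 hempty h1 hcs {c₀}
    rw [card_singleton, Nat.cast_one] at hcb
    -- lower bound: `μ (E c₀) ≤ ψ {c₀}`
    have hlow : μ.real (E c₀) ≤ ψ {c₀} := by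
      show μ.real (E c₀) ≤ ∫ ω, ∏ c ∈ ({c₀} : Finset (BlockIdx d N)), b c ω ∂μ
      simp only [prod_singleton]
      rw [← integral_indicator_one (hEm c₀)]
      refine integral_mono ((integrable_const (1 : ℝ)).indicator (hEm c₀))
        (by simpa only [prod_singleton] using hprod_int {c₀}) fun ω => ?_
      show (E c₀).indicator 1 ω ≤ ε + (1 - ε) * (E c₀).indicator (fun _ => (1 : ℝ)) ω
      by_cases hω : ω ∈ E c₀
      · simp only [Set.indicator_of_mem hω, Pi.one_apply]; linarith
      · simp only [Set.indicator_of_notMem hω]; linarith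
    -- upper bound: `ψ univ ≤ μ (⋂ E) + ε`
    have hup : ψ univ ≤ a + ε := by
      have hpt : ∀ ω, ∏ c ∈ univ, b c ω ≤ (⋂ c, E c).indicator (fun _ => (1 : ℝ)) ω + ε := by
        intro ω
        by_cases hω : ω ∈ ⋂ c, E c
        · rw [Set.indicator_of_mem hω]
          have : ∏ c ∈ univ, b c ω = 1 := prod_eq_one fun c _ => by
            show ε + (1 - ε) * (E c).indicator (fun _ => (1 : ℝ)) ω = 1
            rw [Set.indicator_of_mem (Set.mem_iInter.1 hω c)]; ring
          rw [this]; linarith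
        · rw [Set.indicator_of_notMem hω, zero_add]
          obtain ⟨c₁, hc₁⟩ : ∃ c₁, ω ∉ E c₁ := not_forall.1 fun hall => hω (Set.mem_iInter.2 hall)
          have hb₁ : b c₁ ω = ε := by
            show ε + (1 - ε) * (E c₁).indicator (fun _ => (1 : ℝ)) ω = ε
            rw [Set.indicator_of_notMem hc₁]; ring
          rw [← mul_prod_erase univ (fun c => b c ω) (mem_univ c₁), hb₁]
          have : ∏ c ∈ univ.erase c₁, b c ω ≤ 1 :=
            prod_le_one (fun c _ => (hb01 c ω).1) fun c _ => (hb01 c ω).2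
          nlinarith [prod_nonneg (s := univ.erase c₁) (f := fun c => b c ω) fun c _ => (hb01 c ω).1]
      calc ψ univ = ∫ ω, ∏ c ∈ univ, b c ω ∂μ := rfl
        _ ≤ ∫ ω, (⋂ c, E c).indicator (fun _ => (1 : ℝ)) ω + ε ∂μ :=
            integral_mono (hprod_int univ) (((integrable_const (1 : ℝ)).indicator hInter).add (integrable_const ε))
              hpt
        _ = a + ε := by
            rw [integral_add ((integrable_const (1 : ℝ)).indicator hInter) (integrable_const ε), integral_const,
              smul_eq_mul, probReal_univ, one_mul, ha_def]
            congr 1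
            exact integral_indicator_one hInter
    -- combine
    calc μ.real (E c₀) ≤ ψ {c₀} := hlow
      _ ≤ ψ univ ^ r := hcb
      _ ≤ (a + ε) ^ r := Real.rpow_le_rpow (h0 _) hup hr.le
  -- `ε → 0⁺`
  have hlim : Tendsto (fun ε : ℝ => (a + ε) ^ r) (𝓝[>] 0) (𝓝 (a ^ r)) := by
    have h1 : Tendsto (fun ε : ℝ => a + ε) (𝓝[>] 0) (𝓝 a) :=
      tendsto_nhdsWithin_of_tendsto_nhds ((continuous_const_add a).tendsto' 0 a (add_zero a))
    exact ((Real.continuousAt_rpow_const a r (Or.inr hr.le)).tendsto).comp h1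
  refine ge_of_tendsto hlim ?_
  filter_upwards [Ioo_mem_nhdsGT (zero_lt_one : (0 : ℝ) < 1)] with ε hε
  exact key ε hε.1 hε.2.le

end Abstract

/-! ## §2 One top plaquette of the `SU(n)` Gibbs tower of block averagings -/

section Tower

variable {P : Params} {n : ℕ} [NeZero n] {K M N : ℕ} [NeZero N]

/-- **THE MULTIPLE-REFLECTION BOUND FOR ONE TOP-PLAQUETTE EVENT ON THE GIBBS TOWER.**  For the `SU(n)` Wilson–Gibbs
state at `β ≥ 0` on Bałaban's torus `P`, measurable small-loop averages `ℰ k`, a height `K ≤ m + K_P`, the cube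
torus of the top lattice (`sitesPerDir K = M·N`, `N` even), a measurable `B ⊆ ℝ` and a top plaquette `p` whose far
corners lie in its cube: under the tower law of `(U, Ū, …, Ū^K)`,
`P{dist1 Ū^K(∂p) ∈ B} ≤ P{∀ c, dist1 Ū^K(∂(mirror p c)) ∈ B} ^ (1 ∕ N^d)`. [folklore] -/
theorem towerLaw_real_le_rpow_mirror (P : Params) {β : ℝ} (hβ : 0 ≤ β)
    (ℰ : ℕ → LoopAverage (Matrix.specialUnitaryGroup (Fin n) ℂ))
    (hE : ∀ k l, Measurable fun W : Fin (l + 1) → Matrix.specialUnitaryGroup (Fin n) ℂ => (ℰ k).E W)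
    (K : ℕ) (hK : K ≤ P.m + P.K) (h : P.sitesPerDir K = M * N) (hN : Even N) {B : Set ℝ} (hB : MeasurableSet B)
    (p : Plaq P K) (hp : ∀ j : Fin P.d, baseOffset M p j + extent p j < M) :
    (towerLaw (T4GenFunBounds.gibbsMeasure (G := Matrix.specialUnitaryGroup (Fin n) ℂ) P β)
        (fun k => blockAvg (P := P) (j := k) (ℰ k)) K).real
        {ω | dist1 (GaugeField.plaqHol (last K ω) p) ∈ B} ≤
      ((towerLaw (T4GenFunBounds.gibbsMeasure (G := Matrix.specialUnitaryGroup (Fin n) ℂ) P β)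
        (fun k => blockAvg (P := P) (j := k) (ℰ k)) K).real
        {ω | ∀ c : BlockIdx P.d N, dist1 (GaugeField.plaqHol (last K ω) (mirror h hN p c)) ∈ B}) ^
        ((1 : ℝ) / (N : ℝ) ^ P.d) := by
  set G := Matrix.specialUnitaryGroup (Fin n) ℂ
  haveI := T4GenFunBounds.isProbabilityMeasure_gibbsMeasure (G := G) P hβ
  have hA : ∀ k, Measurable (blockAvg (P := P) (j := k) (ℰ k)).avg := fun k => measurable_avgFun (ℰ k) (hE k)
  haveI := isProbabilityMeasure_towerLaw (T4GenFunBounds.gibbsMeasure (G := G) P β)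
    (fun k => blockAvg (P := P) (j := k) (ℰ k)) hA K
  obtain ⟨hmP, hθm, hθ, hθθ, hRP⟩ := cutoffRP_towerLaw_gibbs_SU_cubes (n := n) P hβ ℰ hE K hK h
  -- the events
  set E : BlockIdx P.d N → Set (Tower P G K) :=
    fun c => {ω | dist1 (GaugeField.plaqHol (last K ω) (mirror h hN p c)) ∈ B} with hE_def
  have hEm : ∀ c, MeasurableSet (E c) := fun c =>
    (RegularGaugeGroup.measurable_dist1.comp ((Missing.measurable_plaqHol _).comp (measurable_last K))) hB
  have hEP : ∀ (i : Fin P.d) (k : ZMod N), ∀ c ∈ halfPlus N i k, MeasurableSet[cubePos G h i k] (E c) :=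
    fun i k c hc => (measurable_dist1_plaqHol_last_cubePos (G := G) h hc (mirror_corners_mem h hN hp c)) hB
  have hcov : ∀ (i : Fin P.d) (k : ZMod N) (c : BlockIdx P.d N) (ω : Tower P G K),
      cubeRefl h i k ω ∈ E c ↔ ω ∈ E (cellReflect i k c) := by
    intro i k c ω
    simp only [hE_def, Set.mem_setOf_eq]
    rw [dist1_plaqHol_last_cubeRefl, cutPlaq_mirror h hN hp]
  have main := measureReal_le_rpow_of_rp (μ := towerLaw (T4GenFunBounds.gibbsMeasure (G := G) P β)
    (fun k => blockAvg (P := P) (j := k) (ℰ k)) K) (cubePos G h) hmP (cubeRefl h) hθm hθ hθθ hRP hN E hEm hEP hcov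
    (cubeOf M N p.src)
  have e0 : E (cubeOf M N p.src) = {ω | dist1 (GaugeField.plaqHol (last K ω) p) ∈ B} := by
    simp only [hE_def, mirror_cubeOf h hN hp]
  have e1 : (⋂ c, E c) = {ω | ∀ c : BlockIdx P.d N, dist1 (GaugeField.plaqHol (last K ω) (mirror h hN p c)) ∈ B} := by
    ext ω; simp only [hE_def, Set.mem_iInter, Set.mem_setOf_eq]
  rw [e0, e1] at main
  exact main

end Tower

/-! ## §3 Pulled back to the Gibbs state and the `K`-fold average -/

section Gibbs

variable {P : Params} {G : Type*} [GaugeGroup G] [MeasurableSpace G]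

/-- **EVENTS OF THE TOP FIELD OF THE TOWER ARE EVENTS OF THE `K`-FOLD AVERAGE**: `P_tower{last ∈ S} = μ{Ū^K ∈ S}`
(`towerLaw_eq_map`, `last_towerPt`). [folklore] -/
theorem towerLaw_real_setOf_last (μ : Measure (GaugeField P 0 G)) {av : (j : ℕ) → Averaging P j G}
    (hA : ∀ j, Measurable (av j).avg) (K : ℕ) {S : Set (GaugeField P K G)} (hS : MeasurableSet S) :
    (towerLaw μ av K).real {ω | last K ω ∈ S} = μ.real {U | Averaging.iter av K U ∈ S} := by
  have hS' : MeasurableSet {ω : Tower P G K | last K ω ∈ S} := hS.preimage (measurable_last K)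
  simp only [Measure.real]
  rw [towerLaw_eq_map μ av hA K, Measure.map_apply (measurable_towerPt av hA K) hS']
  congr 2
  ext U
  simp only [Set.mem_preimage, Set.mem_setOf_eq, last_towerPt]

variable {n : ℕ} [NeZero n] {K M N : ℕ} [NeZero N]

/-- **THE MULTIPLE-REFLECTION BOUND FOR ONE AVERAGED-PLAQUETTE EVENT UNDER THE GIBBS STATE** — the currency of
`HistoryTail`'s STUB 3: for the `SU(n)` Wilson–Gibbs state at `β ≥ 0` on Bałaban's torus, the `K`-fold block average
`Ū^K = Averaging.iter (blockAvg ∘ ℰ) K U`, a measurable `B ⊆ ℝ` and a top plaquette `p` whose far corners lie in its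
cube of the cube torus (`sitesPerDir K = M·N`, `N` even):
`Gibbs{dist1 Ū^K(∂p) ∈ B} ≤ Gibbs{∀ c, dist1 Ū^K(∂(mirror p c)) ∈ B} ^ (1 ∕ N^d)`. [folklore] -/
theorem gibbs_real_iter_le_rpow_mirror (P : Params) {β : ℝ} (hβ : 0 ≤ β)
    (ℰ : ℕ → LoopAverage (Matrix.specialUnitaryGroup (Fin n) ℂ))
    (hE : ∀ k l, Measurable fun W : Fin (l + 1) → Matrix.specialUnitaryGroup (Fin n) ℂ => (ℰ k).E W)
    (K : ℕ) (hK : K ≤ P.m + P.K) (h : P.sitesPerDir K = M * N) (hN : Even N) {B : Set ℝ} (hB : MeasurableSet B)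
    (p : Plaq P K) (hp : ∀ j : Fin P.d, baseOffset M p j + extent p j < M) :
    (T4GenFunBounds.gibbsMeasure (G := Matrix.specialUnitaryGroup (Fin n) ℂ) P β).real
        {U | dist1 (GaugeField.plaqHol
          (Averaging.iter (fun k => blockAvg (P := P) (j := k) (ℰ k)) K U) p) ∈ B} ≤
      ((T4GenFunBounds.gibbsMeasure (G := Matrix.specialUnitaryGroup (Fin n) ℂ) P β).real
        {U | ∀ c : BlockIdx P.d N, dist1 (GaugeField.plaqHol
          (Averaging.iter (fun k => blockAvg (P := P) (j := k) (ℰ k)) K U) (mirror h hN p c)) ∈ B}) ^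
        ((1 : ℝ) / (N : ℝ) ^ P.d) := by
  set G := Matrix.specialUnitaryGroup (Fin n) ℂ
  have hA : ∀ k, Measurable (blockAvg (P := P) (j := k) (ℰ k)).avg := fun k => measurable_avgFun (ℰ k) (hE k)
  have hS₁ : MeasurableSet {V : GaugeField P K G | dist1 (GaugeField.plaqHol V p) ∈ B} :=
    (RegularGaugeGroup.measurable_dist1.comp (Missing.measurable_plaqHol _)) hB
  have hS₂ : MeasurableSet {V : GaugeField P K G | ∀ c : BlockIdx P.d N,
      dist1 (GaugeField.plaqHol V (mirror h hN p c)) ∈ B} := by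
    have : {V : GaugeField P K G | ∀ c : BlockIdx P.d N, dist1 (GaugeField.plaqHol V (mirror h hN p c)) ∈ B} =
        ⋂ c, {V | dist1 (GaugeField.plaqHol V (mirror h hN p c)) ∈ B} := by
      ext V; simp only [Set.mem_setOf_eq, Set.mem_iInter]
    rw [this]
    exact MeasurableSet.iInter fun c => (RegularGaugeGroup.measurable_dist1.comp (Missing.measurable_plaqHol _)) hB
  have h1 := towerLaw_real_setOf_last (T4GenFunBounds.gibbsMeasure (G := G) P β) hA K hS₁
  have h2 := towerLaw_real_setOf_last (T4GenFunBounds.gibbsMeasure (G := G) P β) hA K hS₂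
  simp only [Set.mem_setOf_eq] at h1 h2
  rw [← h1, ← h2]
  exact towerLaw_real_le_rpow_mirror P hβ ℰ hE K hK h hN hB p hp

end Gibbs

end

end Summit.QuantumFields.YangMills.Theorems.HistoryTailChessboardOnePlaquette
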